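import Summits.KontsevichZagierPeriods.KontsevichZagierPeriods.Theses.TorsionLogs
import Literature.NumberTheory.Transcendental.KZProductIdeal

/-!
# F3 WITNESS for the rung `NeronTorsionLengths` (line `NeronTorsionDepthThree` on crux `TorsionSectorComplete`,
# stmt-KontsevichZagierPeriods-14212; forward generator G1 `next-rung`, gen 11, seed g1-KontsevichZagierPeriods-17981)

The rung is the length-graded family `NeronTorsionLengthMember : Bool → Prop` — member `false` := the floor decl
`Theses.TorsionLogs.NeronTorsionPrimitiveChain` VERBATIM (ℓ = 2, the seed, CLOSED), member `true` := the tied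
length-three Néron–torsion sector statement `NeronTorsionDepthThreeSector` (ℓ = 3) — and
`NeronTorsionLengths := ∀ three, NeronTorsionLengthMember three`.  The floor specialises the rung at the parameter
`three := false`: the seed theorem (route link `Theses.TorsionLogs.NeronTorsionPrimitiveChain_holds :=
Cruxes.NeronTorsionSector.Translation.stub_assembly`, item stmt-KontsevichZagierPeriods-17981) IS that member (`Iff.rfl`).
No `sorry`.  Self-contained: verbatim copies of the three `def`s of `Lines/NeronTorsionDepthThree.lean` in the namespace
`…NeronTorsionDepthThree.Special` (the skeleton module proves the same fact about the registered decl as `rung_false`).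
[cite: KontsevichZagier2001, §1.2]
-/

noncomputable section

-- `Summit.KontsevichZagierPeriods.KontsevichZagierPeriods.…` is the tree's mandated layout (single-conjunct summit).
set_option linter.dupNamespace false

namespace Summit.KontsevichZagierPeriods.KontsevichZagierPeriods.Cruxes.TorsionSectorComplete.NeronTorsionDepthThree.Special

open Literature.NumberTheory.Transcendental
open Summit.KontsevichZagierPeriods.KontsevichZagierPeriods.Theses.TorsionLogs (NeronTorsionPrimitiveChain
  NeronTorsionPrimitiveChain_holds)

/-- Verbatim copy of `Lines/NeronTorsionDepthThree.lean :: NeronTorsionDepthThreeSector` (member `true`, ℓ = 3). -/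
def NeronTorsionDepthThreeSector : Prop :=
  ∀ (g₂ g₃ e₁ xP yP B : ℝ) (N a : ℕ) (c : ℤ) (f : ℝ → ℝ),
    (∀ x, f x = 4 * x ^ 3 - g₂ * x - g₃) → g₂ ^ 3 - 27 * g₃ ^ 2 ≠ 0 → f e₁ = 0 → 0 < e₁ →
    (∀ x, e₁ < x → 0 < f x) → e₁ < xP → yP ^ 2 = f xP → 3 ≤ N → 0 < a → 2 * a < N →
    (∀ hns : (⟨0, 0, 0, -g₂ / 4, -g₃ / 4⟩ : WeierstrassCurve ℝ).toAffine.Nonsingular xP (yP / 2),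
      addOrderOf (WeierstrassCurve.Affine.Point.some xP (yP / 2) hns) = N) →
    (N : ℝ) * (∫ x in Set.Ioi xP, (Real.sqrt (f x))⁻¹) = a * (2 * ∫ x in Set.Ioi e₁, (Real.sqrt (f x))⁻¹) →
    1 < B →
    ∀ (r3P r3O : KZ.IntegralRep 3) (rJp rJm : KZ.IntegralRep 2) (rEta rA rB : KZ.IntegralRep 1),
    r3P.domain = {z | e₁ < z 2 ∧ z 2 < z 1 ∧ z 1 < z 0 ∧ z 0 < xP} →
    Set.EqOn r3P.integrand
      (fun z => z 2 / (Real.sqrt (f (z 2)) * Real.sqrt (f (z 1)) * Real.sqrt (f (z 0)))) r3P.domain →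
    r3O.domain = {z | e₁ < z 2 ∧ z 2 < z 1 ∧ z 1 < z 0} →
    Set.EqOn r3O.integrand
      (fun z => z 2 / (Real.sqrt (f (z 2)) * Real.sqrt (f (z 1)) * Real.sqrt (f (z 0)))) r3O.domain →
    rJp.domain = {z | xP < z 0 ∧ 1 < z 1 ∧
      z 1 < ((⟨0, 0, 0, -g₂ / 4, -g₃ / 4⟩ : WeierstrassCurve ℝ).ΨSq N).eval (z 0)} →
    Set.EqOn rJp.integrand (fun z => (z 1)⁻¹ * (Real.sqrt (f (z 0)))⁻¹) rJp.domain →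
    rJm.domain = {z | xP < z 0 ∧
      ((⟨0, 0, 0, -g₂ / 4, -g₃ / 4⟩ : WeierstrassCurve ℝ).ΨSq N).eval (z 0) < z 1 ∧ z 1 < 1} →
    Set.EqOn rJm.integrand (fun z => (z 1)⁻¹ * (Real.sqrt (f (z 0)))⁻¹) rJm.domain →
    rEta.domain = {t | e₁ < t 0} →
    Set.EqOn rEta.integrand (fun t => (g₂ * t 0 + 2 * g₃) / (2 * (t 0) ^ 2 * Real.sqrt (f (t 0)))) rEta.domain →
    rA.domain = {t | e₁ < t 0} → Set.EqOn rA.integrand (fun t => (Real.sqrt (f (t 0)))⁻¹) rA.domain →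
    rB.domain = {t | 1 < t 0 ∧ t 0 < B} → Set.EqOn rB.integrand (fun t => (t 0)⁻¹) rB.domain →
    12 * (N : ℝ) ^ 3 * r3P.value - 12 * ((N : ℝ) ^ 3 - 2 * a) * r3O.value
      + 6 * (N : ℝ) * (rJp.value - rJm.value)
      - 2 * a * (4 * (a : ℝ) ^ 2 - 6 * a * N + 3 * (N : ℝ) ^ 2 - 1) * (rEta.value * rA.value * rA.value)
      - c * (rA.value * rB.value) = 0 →
    (12 * (N : ℤ) ^ 3) • KZ.of r3P - (12 * ((N : ℤ) ^ 3 - 2 * a)) • KZ.of r3O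
      + (6 * (N : ℤ)) • (KZ.of rJp - KZ.of rJm)
      - (2 * (a : ℤ) * (4 * (a : ℤ) ^ 2 - 6 * a * N + 3 * (N : ℤ) ^ 2 - 1)) • (KZ.of rEta * KZ.of rA * KZ.of rA)
      - c • (KZ.of rA * KZ.of rB) ∈ KZ.relations

/-- Verbatim copy of `Lines/NeronTorsionDepthThree.lean :: NeronTorsionLengthMember` (the family, graded by ℓ). -/
def NeronTorsionLengthMember : Bool → Prop
  | false => NeronTorsionPrimitiveChain
  | true => NeronTorsionDepthThreeSector

/-- Verbatim copy of `Lines/NeronTorsionDepthThree.lean :: NeronTorsionLengths` (THE RUNG). -/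
def NeronTorsionLengths : Prop := ∀ three : Bool, NeronTorsionLengthMember three

/-- Member `false` is the floor decl on the nose. -/
theorem false_iff : NeronTorsionLengthMember false ↔ NeronTorsionPrimitiveChain :=
  Iff.rfl

/-- **F3 witness (named):** the floor (seed `stub_assembly`, route link `NeronTorsionPrimitiveChain_holds`) is the
member `false` of the family. -/
theorem rung_false : NeronTorsionLengthMember false :=
  NeronTorsionPrimitiveChain_holds

/-- The rung is exactly `floor ∧ member true` (honest containment: the rung adds ONE statement to the floor). -/
theorem rung_iff : NeronTorsionLengths ↔ NeronTorsionPrimitiveChain ∧ NeronTorsionDepthThreeSector := by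
  constructor
  · exact fun h => ⟨h false, h true⟩
  · rintro ⟨h₂, h₃⟩ (_ | _)
    · exact h₂
    · exact h₃

/-- Given the floor (a theorem), the rung is equivalent to its new member. -/
theorem rung_iff_true : NeronTorsionLengths ↔ NeronTorsionLengthMember true :=
  ⟨fun h => h true, fun h => rung_iff.mpr ⟨NeronTorsionPrimitiveChain_holds, h⟩⟩

end Summit.KontsevichZagierPeriods.KontsevichZagierPeriods.Cruxes.TorsionSectorComplete.NeronTorsionDepthThree.Special

end
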